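import Literature.NumberTheory.Automorphic.LocalHermitianFormsRankThreeCongruence
import Literature.NumberTheory.Rogawski1990.CartanRealisation
import HarnessLib

/-!
# The conjugacy classes inside a LOCAL stable class of `U(H)(F_v)` at a non-split place: realisation of Cartan classes with norm determinant,
# and, for a torus of type (1) (three distinct norm-one eigenvalues in `E_v`), the classes READ IN THE EIGENFRAME
# (Rogawski 1990, §3.1 p. 19, §3.5 Prop. 3.5.2 (a)(c) p. 29, §3.6 p. 31; Kottwitz 1986 §7)

Topic `NumberTheory/Rogawski1990`; namespace `Literature.NumberTheory.Rogawski1990`.  **THEOREMS ONLY** (no definition, no named fact, no instance, no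
notation, no `sorry`).  Cell `pub/hodgecm-mathlib`, programme P3a, road «D-N7-inert» (inert unit fundamental lemma [Rogawski1990, Prop. 4.9.1 (b)], map
§3 (L4)∕§5 (D5)), brick **(L4a) «LOCAL CLASS SET + κ_H»**, FILE 1: the LOCAL twin at ONE non-split finite place of ★ `CartanRealisation` §2 (which realises
Cartan classes over the CM FIELD by Landherr), on top of ★ `CartanInvariant` (`twistGram σ H g = ᵗ(σg) H g`, ★ `exists_unitary_conj_of_twistGram_eq`),
★ `CartanRealisation` §1 (★ `conj_mem_unitaryGroup_of_twistGram_eq_mul`, ★ `det_inv_mul_twistGram`) and ★ `LocalHermitianFormsRankThreeCongruence`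
(`exists_formCongr_eq_iff_det_three`).  HC_CM is proved only modulo the printed citations until rung 0 closes; this file is unconditional local algebra.

THE PRINT.  [Rogawski1990, §3.1 p. 19]: «`𝔇(I∕F)` parametrizes the set of conjugacy classes within the stable conjugacy class of `γ`»; [§3.5 Prop. 3.5.2
p. 29]: (a) `H¹(F, T) ≅ L ∕ N_{L′∕L}(L′^*)`, (c) for `T` anisotropic `𝓔(T∕F) ≅ {(ε_j) ∈ (ℤ∕2)^r : Σ ε_j = 0}`, `|𝓡(T∕F)| = 2^{r−1}`; [§3.6 p. 31]: type (1)
`T = E¹ × E¹ × E¹` (`r = 3`).  Cohomology-free model: the `U(H)(F_v)`-classes in the stable class of `γ` are read on the transported forms `H_g = ᵗ(σg) H g`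
of the stable conjugators `g` (`g γ g⁻¹ ∈ U(H)(F_v)`), i.e. on the Cartan classes `x = H⁻¹ H_g ∈ Z(γ)` modulo `x ∼ t⋆ x t`.
* §1 FRAME ALGEBRA (any field `K`, any `n`): for `γ ∈ U(H)(K)` with an EIGENFRAME `γ P = P · diag(u)`, `u` injective, `σ(u_i) u_i = 1` (type (1)): `H_P`
  is DIAGONAL (`twistGram_eigenframe_eq_diagonal`: eigenlines are `H`-orthogonal), `Z(γ)` is diagonal in the frame (`conj_eq_diagonal_of_commute`),
  `x⋆ = x` iff the frame coordinates are `σ`-fixed (`hermStar_eigenframe_diagonal_eq_self_iff`), and for every stable conjugator `g` the Gram matrix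
  `H_{gP}` of `H` in the eigenframe `gP` of `g γ g⁻¹` is diagonal (`twistGram_mul_eigenframe_eq_diagonal`) with `∏ᵢ (H_{gP})ᵢᵢ = N(det g) · ∏ᵢ (H_P)ᵢᵢ`.
* §2 LOCAL REALISATION (`K = E_v` at a non-split `v`, `σ = c ⊗ 1`, rank 3): a `⋆`-symmetric `x ∈ Z(γ)` is a Cartan class `H⁻¹ H_g` **iff `det x` is a
  norm** (`exists_twistGram_eq_mul_iff_det`), whence the realised element of the stable class (`exists_isStablyConj_inv_mul_twistGram_eq_of_det`; no Hasse
  principle at one place); for type (1) EVERY vector of `σ`-fixed units `(rᵢ)` with `∏ rᵢ` a norm is realised (`exists_conj_mem_twistGram_eigenframe_eq`).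
The CRITERION in the frame (`g γ g⁻¹ ∼ g′ γ g′⁻¹` iff the eigenvector lengths differ by norms), the COUNT (`4` classes ↔ `(ε₁,ε₂,ε₃)`, `Σ εᵢ = 0`, by the
local norm index `2`) and the reading of ★ `finKappaAt` on the parametrisation are the sequel `LocalStableClassesNonsplitCount`.

## References
* [Rogawski1990] J. D. Rogawski, *Automorphic Representations of Unitary Groups in Three Variables*, Ann. of Math. Stud. 123 (1990), §3.1 p. 19, §3.3
  Prop. 3.3.1 p. 22, §3.5 Prop. 3.5.2 p. 29, §3.6 p. 31.
* [Kottwitz1986] R. E. Kottwitz, *Stable trace formula: elliptic singular terms*, Math. Ann. 275 (1986), §7.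
* [Jacobowitz1962] R. Jacobowitz, *Hermitian forms over local fields*, Amer. J. Math. 84 (1962), §3 Thm. 3.1.
-/

set_option autoImplicit false

noncomputable section

open Matrix NumberField IsDedekindDomain
open scoped MatrixGroups

namespace Literature.NumberTheory.Rogawski1990

open Literature.NumberTheory.Automorphic Literature.NumberTheory.Automorphic.UnitaryGroup
open Literature.AlgebraicGeometry.ShimuraVarieties (unitaryGroup mem_unitaryGroup_iff)

/-! ## §1 Frame algebra: a unitary element with an eigenframe of distinct norm-one eigenvalues (type (1)) -/

section Frame

variable {K : Type*} [Field K] (σ : K →+* K) {n : Type*} [Fintype n] [DecidableEq n]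

/-- A matrix commuting with a diagonal matrix with DISTINCT entries is diagonal. [folklore] -/
private theorem eq_diagonal_of_commute_diagonal {u : n → K} (hu : Function.Injective u) {y : Matrix n n K} (hy : Commute y (diagonal u)) :
    y = diagonal fun i => y i i := by
  ext i j
  by_cases hij : i = j
  · subst hij
    rw [diagonal_apply_eq]
  · rw [diagonal_apply_ne _ hij]
    have h := congrFun (congrFun hy.eq i) j
    rw [mul_diagonal, diagonal_mul] at h
    have h2 : (u j - u i) * y i j = 0 := by linear_combination h
    rcases mul_eq_zero.1 h2 with h3 | h3
    · exact absurd (hu (sub_eq_zero.1 h3)).symm hij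
    · exact h3

variable (H : Matrix n n K)

/-- `P · P⁻¹ = 1` on matrices for `P ∈ GL_n`. [folklore] -/
private theorem coe_mul_coe_inv (P : GL n K) : P.val * (P⁻¹).val = 1 := by
  rw [← Units.val_mul, mul_inv_cancel, Units.val_one]

/-- `P⁻¹ · P = 1` on matrices for `P ∈ GL_n`. [folklore] -/
private theorem coe_inv_mul_coe (P : GL n K) : (P⁻¹).val * P.val = 1 := by
  rw [← Units.val_mul, inv_mul_cancel, Units.val_one]

/-- `det P ≠ 0` for `P ∈ GL_n(K)`. [folklore] -/
private theorem det_coe_ne_zero (P : GL n K) : P.val.det ≠ 0 := by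
  have h := P.isUnit
  rw [Matrix.isUnit_iff_isUnit_det] at h
  exact h.ne_zero

/-- **In an eigenframe the centraliser is diagonal**: if `γ P = P · diag(u)` with `u` injective and `x` commutes with `γ`, then `P⁻¹ x P` is diagonal.
[cite: Rogawski1990, §3.5 p. 29] -/
theorem conj_eq_diagonal_of_commute {γ : Matrix n n K} {P : GL n K} {u : n → K} (hP : γ * P.val = P.val * diagonal u)
    (hu : Function.Injective u) {x : Matrix n n K} (hx : Commute x γ) :
    (P⁻¹).val * x * P.val = diagonal fun i => ((P⁻¹).val * x * P.val) i i := by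
  apply eq_diagonal_of_commute_diagonal hu
  have hD : diagonal u = (P⁻¹).val * γ * P.val := by
    rw [Matrix.mul_assoc, hP, ← Matrix.mul_assoc, coe_inv_mul_coe, Matrix.one_mul]
  have e : P.val * ((P⁻¹).val * (γ * P.val)) = γ * P.val := by rw [← Matrix.mul_assoc, coe_mul_coe_inv, Matrix.one_mul]
  have e' : P.val * ((P⁻¹).val * (x * P.val)) = x * P.val := by rw [← Matrix.mul_assoc, coe_mul_coe_inv, Matrix.one_mul]
  rw [hD]
  show (P⁻¹).val * x * P.val * ((P⁻¹).val * γ * P.val) = (P⁻¹).val * γ * P.val * ((P⁻¹).val * x * P.val)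
  have e2 : (P⁻¹).val * x * P.val * ((P⁻¹).val * γ * P.val) = (P⁻¹).val * (x * γ) * P.val := by
    simp only [Matrix.mul_assoc, e]
  have e3 : (P⁻¹).val * γ * P.val * ((P⁻¹).val * x * P.val) = (P⁻¹).val * (γ * x) * P.val := by
    simp only [Matrix.mul_assoc, e']
  rw [e2, e3, hx.eq]

/-- Conversely `P · diag(d) · P⁻¹` commutes with `γ` when `γ P = P · diag(u)`. [cite: Rogawski1990, §3.5 p. 29] -/
theorem commute_eigenframe_diagonal {γ : Matrix n n K} {P : GL n K} {u : n → K} (hP : γ * P.val = P.val * diagonal u)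
    (d : n → K) : Commute (P.val * diagonal d * (P⁻¹).val) γ := by
  have hγ : γ = P.val * diagonal u * (P⁻¹).val := by
    rw [← hP, Matrix.mul_assoc, coe_mul_coe_inv, Matrix.mul_one]
  have e : ∀ Y : Matrix n n K, (P⁻¹).val * (P.val * Y) = Y := fun Y => by rw [← Matrix.mul_assoc, coe_inv_mul_coe, Matrix.one_mul]
  rw [hγ]
  show P.val * diagonal d * (P⁻¹).val * (P.val * diagonal u * (P⁻¹).val) = P.val * diagonal u * (P⁻¹).val * (P.val * diagonal d * (P⁻¹).val)
  have e2 : P.val * diagonal d * (P⁻¹).val * (P.val * diagonal u * (P⁻¹).val) = P.val * (diagonal d * diagonal u) * (P⁻¹).val := by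
    simp only [Matrix.mul_assoc, e]
  have e3 : P.val * diagonal u * (P⁻¹).val * (P.val * diagonal d * (P⁻¹).val) = P.val * (diagonal u * diagonal d) * (P⁻¹).val := by
    simp only [Matrix.mul_assoc, e]
  rw [e2, e3, (commute_diagonal d u).eq]

/-- `det (P · diag(d) · P⁻¹) = ∏ dᵢ`. [folklore] -/
private theorem det_eigenframe_diagonal (P : GL n K) (d : n → K) : (P.val * diagonal d * (P⁻¹).val).det = ∏ i, d i := by
  rw [Matrix.det_mul, Matrix.det_mul, det_diagonal, mul_comm, ← mul_assoc, ← Matrix.det_mul, coe_inv_mul_coe, Matrix.det_one, one_mul]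

/-- **The eigenlines of a unitary element with distinct NORM-ONE eigenvalues are `H`-orthogonal**: for `γ ∈ U(H)(K)` with `γ P = P · diag(u)`,
`u` injective, `σ(u_i) u_i = 1`, the Gram matrix `H_P = ᵗ(σP) H P` of `H` in the eigenframe is DIAGONAL (`σ(u_i) (H_P)_{ij} u_j = (H_P)_{ij}`, so
`(u_j − u_i)(H_P)_{ij} = 0`).  Type (1) of [Rogawski1990, §3.6]: `T = Z(γ) ≅ (E¹)³` sits diagonally in an orthogonal frame. [cite: Rogawski1990, §3.6 p. 31; §3.5 p. 29] -/
theorem twistGram_eigenframe_eq_diagonal {γ : GL n K} (hγ : γ ∈ unitaryGroup σ H) {P : GL n K} {u : n → K}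
    (hP : γ.val * P.val = P.val * diagonal u) (hu : Function.Injective u) (hu1 : ∀ i, σ (u i) * u i = 1) :
    twistGram σ H P.val = diagonal fun i => twistGram σ H P.val i i := by
  -- `ᵗσ(γP) H (γP)` two ways
  have h1 : twistGram σ H (γ.val * P.val) = twistGram σ H P.val := twistGram_unitary_mul σ H hγ _
  have h2 : twistGram σ H (P.val * diagonal u) = (diagonal fun m => σ (u m)) * twistGram σ H P.val * diagonal u := by
    rw [twistGram_mul, diagonal_map (map_zero σ), diagonal_transpose]
  rw [hP, h2] at h1
  ext i j
  by_cases hij : i = j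
  · subst hij; rw [diagonal_apply_eq]
  · rw [diagonal_apply_ne _ hij]
    have h := congrFun (congrFun h1 i) j
    rw [mul_diagonal, diagonal_mul] at h
    have h5 : u i * σ (u i) = 1 := by rw [mul_comm]; exact hu1 i
    have h3 : (u j - u i) * twistGram σ H P.val i j = 0 := by
      linear_combination (u i) * h - (twistGram σ H P.val i j * u j) * h5
    rcases mul_eq_zero.1 h3 with h6 | h6
    · exact absurd (hu (sub_eq_zero.1 h6)).symm hij
    · exact h6

/-- The diagonal Gram entries `(H_P)ᵢᵢ = ⟨p_i, p_i⟩_H` are non-zero when `H` is non-degenerate. [cite: Rogawski1990, §3.5 p. 29] -/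
theorem twistGram_eigenframe_apply_ne_zero (hHd : H.det ≠ 0) {γ : GL n K} (hγ : γ ∈ unitaryGroup σ H) {P : GL n K} {u : n → K}
    (hP : γ.val * P.val = P.val * diagonal u) (hu : Function.Injective u) (hu1 : ∀ i, σ (u i) * u i = 1)
    (i : n) : twistGram σ H P.val i i ≠ 0 := by
  intro h0
  have hdet : (twistGram σ H P.val).det = 0 := by
    rw [twistGram_eigenframe_eq_diagonal σ H hγ hP hu hu1, det_diagonal]
    exact Finset.prod_eq_zero (Finset.mem_univ i) h0
  rw [det_twistGram] at hdet
  exact mul_ne_zero (mul_ne_zero ((map_ne_zero σ).2 (det_coe_ne_zero P)) hHd) (det_coe_ne_zero P) hdet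

omit [DecidableEq n] in
/-- The diagonal Gram entries are `σ`-fixed when `H` is `σ`-hermitian and `σ` an involution. [cite: Rogawski1990, §3.5 p. 29] -/
theorem map_twistGram_apply_self (hσ : ∀ r : K, σ (σ r) = r) (hH : (H.map σ)ᵀ = H) (g : Matrix n n K) (i : n) :
    σ (twistGram σ H g i i) = twistGram σ H g i i := by
  have h := congrFun (congrFun (conjTranspose_twistGram σ H hσ hH g) i) i
  rwa [transpose_apply, map_apply] at h

/-- **Transporting `H · x` to the eigenframe**: `ᵗ(σP) · (H · P diag(r) P⁻¹) · P = H_P · diag(r)`. [cite: Rogawski1990, §3.5 p. 29] -/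
theorem twistGram_frame_mul_eigenframe_diagonal (P : GL n K) (r : n → K) :
    (P.val.map σ)ᵀ * (H * (P.val * diagonal r * (P⁻¹).val)) * P.val = twistGram σ H P.val * diagonal r := by
  rw [twistGram_def]
  simp only [Matrix.mul_assoc, coe_inv_mul_coe, Matrix.mul_one]

/-- **`x⋆ = x` in the eigenframe ⟺ the frame coordinates are `σ`-fixed**: for `x = P · diag(r) · P⁻¹` in a type (1) frame of `γ ∈ U(H)(K)` (`H`
hermitian non-degenerate), `hermStar σ H x = x ↔ ∀ i, σ(rᵢ) = rᵢ` — both sides of `ᵗ(σx) H = H x` become diagonal in the frame, with entries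
`σ(rᵢ) (H_P)ᵢᵢ` and `(H_P)ᵢᵢ rᵢ`.  (So the `⋆`-symmetric part of `Z(γ) ≅ E_v³` is `F_v³`: [Prop. 3.5.2 (a)] `L = (L′)^{α′}` for type (1).)
[cite: Rogawski1990, §3.5 Prop. 3.5.2 (a) p. 29] -/
theorem hermStar_eigenframe_diagonal_eq_self_iff (hHd : H.det ≠ 0)
    {γ : GL n K} (hγ : γ ∈ unitaryGroup σ H) {P : GL n K} {u : n → K}
    (hP : γ.val * P.val = P.val * diagonal u) (hu : Function.Injective u) (hu1 : ∀ i, σ (u i) * u i = 1) (r : n → K) :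
    hermStar σ H (P.val * diagonal r * (P⁻¹).val) = P.val * diagonal r * (P⁻¹).val ↔ ∀ i, σ (r i) = r i := by
  have hHu : IsUnit H.det := Ne.isUnit hHd
  set x := P.val * diagonal r * (P⁻¹).val with hxdef
  clear_value x
  -- `x⋆ = x ↔ ᵗ(σx) H = H x`
  have e0 : hermStar σ H x = x ↔ (x.map σ)ᵀ * H = H * x := by
    rw [hermStar_def]
    constructor
    · intro h
      calc (x.map σ)ᵀ * H = H * (H⁻¹ * (x.map σ)ᵀ * H) := by
            rw [← Matrix.mul_assoc, ← Matrix.mul_assoc, Matrix.mul_nonsing_inv H hHu, Matrix.one_mul]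
        _ = H * x := by rw [h]
    · intro h
      rw [Matrix.mul_assoc, h, ← Matrix.mul_assoc, Matrix.nonsing_inv_mul H hHu, Matrix.one_mul]
  -- both sides in the frame
  have hT := twistGram_eigenframe_eq_diagonal σ H hγ hP hu hu1
  have eR : (P.val.map σ)ᵀ * (H * x) * P.val = diagonal fun i => twistGram σ H P.val i i * r i := by
    rw [hxdef, twistGram_frame_mul_eigenframe_diagonal]
    conv_lhs => rw [hT, diagonal_mul_diagonal]
  have hxP : x * P.val = P.val * diagonal r := by
    rw [hxdef, Matrix.mul_assoc, coe_inv_mul_coe, Matrix.mul_one]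
  have eL : (P.val.map σ)ᵀ * ((x.map σ)ᵀ * H) * P.val = diagonal fun i => σ (r i) * twistGram σ H P.val i i := by
    have e1 : (P.val.map σ)ᵀ * (x.map σ)ᵀ = ((x * P.val).map σ)ᵀ := by rw [Matrix.map_mul, transpose_mul]
    rw [← Matrix.mul_assoc, e1, hxP, Matrix.map_mul, transpose_mul, diagonal_map (map_zero σ), diagonal_transpose, Matrix.mul_assoc,
      Matrix.mul_assoc, ← Matrix.mul_assoc ((P.val.map σ))ᵀ, ← twistGram_def]
    conv_lhs => rw [hT, diagonal_mul_diagonal]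
  -- cancelling the invertible frame
  have hPu : IsUnit P.val := P.isUnit
  have hPσu : IsUnit (P.val.map σ)ᵀ := by
    rw [Matrix.isUnit_transpose, Matrix.isUnit_iff_isUnit_det, ← RingHom.mapMatrix_apply, ← RingHom.map_det]
    exact ((Matrix.isUnit_iff_isUnit_det _).1 hPu).map _
  rw [e0]
  constructor
  · intro h i
    have h2 : (P.val.map σ)ᵀ * ((x.map σ)ᵀ * H) * P.val = (P.val.map σ)ᵀ * (H * x) * P.val := by rw [h]
    rw [eL, eR] at h2
    have h3 := congrFun (congrFun h2 i) i
    rw [diagonal_apply_eq, diagonal_apply_eq] at h3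
    have h4 := mul_right_cancel₀ (twistGram_eigenframe_apply_ne_zero σ H hHd hγ hP hu hu1 i) (h3.trans (mul_comm _ _))
    exact h4
  · intro h
    have h2 : (P.val.map σ)ᵀ * ((x.map σ)ᵀ * H) * P.val = (P.val.map σ)ᵀ * (H * x) * P.val := by
      rw [eL, eR]
      congr 1
      funext i
      rw [h i, mul_comm]
    exact hPσu.mul_left_cancel (hPu.mul_right_cancel h2)

/-- **The Gram matrix in the eigenframe of a conjugate.**  If `g γ g⁻¹ ∈ U(H)(K)` (a stable conjugator) then `H_{gP} = ᵗ(σ(gP)) H (gP) = H_P · (P⁻¹ x P)`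
with `x = H⁻¹ H_g ∈ Z(γ)` (★ `commute_inv_mul_twistGram`) and `P⁻¹ x P` diagonal (type (1) frame).  Its entries `(H_{gP})ᵢᵢ = ⟨g p_i, g p_i⟩_H` are the
`H`-lengths of the eigenvectors `g p_i` of `g γ g⁻¹`. [cite: Rogawski1990, §3.1 p. 19; §3.5 Prop. 3.5.2 (a) p. 29] -/
theorem twistGram_mul_eigenframe_eq (hHd : H.det ≠ 0) {γ : GL n K} (hγ : γ ∈ unitaryGroup σ H) {P : GL n K} {u : n → K}
    (hP : γ.val * P.val = P.val * diagonal u) (hu : Function.Injective u)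
    {g : GL n K} (hg : g * γ * g⁻¹ ∈ unitaryGroup σ H) :
    twistGram σ H (g.val * P.val) =
      twistGram σ H P.val * diagonal fun i => ((P⁻¹).val * (H⁻¹ * twistGram σ H g.val) * P.val) i i := by
  have hHu : IsUnit H.det := Ne.isUnit hHd
  have hx : Commute (H⁻¹ * twistGram σ H g.val) γ.val :=
    commute_inv_mul_twistGram σ H hHu (γ := ⟨γ, hγ⟩) (δ := ⟨g * γ * g⁻¹, hg⟩) rfl
  have hdiag := conj_eq_diagonal_of_commute hP hu hx
  have e : P.val * ((P⁻¹).val * (H⁻¹ * (twistGram σ H g.val * P.val))) = H⁻¹ * (twistGram σ H g.val * P.val) := by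
    rw [← Matrix.mul_assoc P.val, coe_mul_coe_inv, Matrix.one_mul]
  rw [← hdiag]
  calc twistGram σ H (g.val * P.val)
      = (P.val.map σ)ᵀ * twistGram σ H g.val * P.val := twistGram_mul σ H _ _
    _ = (P.val.map σ)ᵀ * (H * (H⁻¹ * twistGram σ H g.val)) * P.val := by
        rw [← Matrix.mul_assoc H, Matrix.mul_nonsing_inv H hHu, Matrix.one_mul]
    _ = (P.val.map σ)ᵀ * H * P.val * ((P⁻¹).val * (H⁻¹ * twistGram σ H g.val) * P.val) := by
        simp only [Matrix.mul_assoc, e]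
    _ = twistGram σ H P.val * ((P⁻¹).val * (H⁻¹ * twistGram σ H g.val) * P.val) := by rw [twistGram_def σ H P.val]

/-- Hence `H_{gP}` is diagonal, with `(H_{gP})ᵢᵢ = (H_P)ᵢᵢ · (P⁻¹ x P)ᵢᵢ` (type (1) frame). [cite: Rogawski1990, §3.5 Prop. 3.5.2 (a) p. 29] -/
theorem twistGram_mul_eigenframe_eq_diagonal (hHd : H.det ≠ 0) {γ : GL n K} (hγ : γ ∈ unitaryGroup σ H) {P : GL n K} {u : n → K}
    (hP : γ.val * P.val = P.val * diagonal u) (hu : Function.Injective u) (hu1 : ∀ i, σ (u i) * u i = 1)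
    {g : GL n K} (hg : g * γ * g⁻¹ ∈ unitaryGroup σ H) :
    twistGram σ H (g.val * P.val) = diagonal fun i => twistGram σ H (g.val * P.val) i i := by
  have h := twistGram_mul_eigenframe_eq σ H hHd hγ hP hu hg
  rw [twistGram_eigenframe_eq_diagonal σ H hγ hP hu hu1, diagonal_mul_diagonal] at h
  rw [h]
  ext i j
  by_cases hij : i = j
  · subst hij; simp only [diagonal_apply_eq]
  · rw [diagonal_apply_ne _ hij, diagonal_apply_ne _ hij]

/-- **The determinant constraint in the frame**: `∏ᵢ (H_{gP})ᵢᵢ = σ(det g) det g · ∏ᵢ (H_P)ᵢᵢ` — the product of the frame ratios of a class is a NORM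
(★ `det_inv_mul_twistGram`: the source of «`Σ ε_j = 0`» in [Prop. 3.5.2 (c)]). [cite: Rogawski1990, §3.5 Prop. 3.5.2 (c) p. 29] -/
theorem prod_twistGram_mul_eigenframe_eq (hHd : H.det ≠ 0) {γ : GL n K} (hγ : γ ∈ unitaryGroup σ H) {P : GL n K} {u : n → K}
    (hP : γ.val * P.val = P.val * diagonal u) (hu : Function.Injective u) (hu1 : ∀ i, σ (u i) * u i = 1)
    {g : GL n K} (hg : g * γ * g⁻¹ ∈ unitaryGroup σ H) :
    ∏ i, twistGram σ H (g.val * P.val) i i = σ g.val.det * g.val.det * ∏ i, twistGram σ H P.val i i := by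
  have h1 : (twistGram σ H (g.val * P.val)).det = ∏ i, twistGram σ H (g.val * P.val) i i := by
    rw [twistGram_mul_eigenframe_eq_diagonal σ H hHd hγ hP hu hu1 hg, det_diagonal]
    simp only [diagonal_apply_eq]
  have h2 : (twistGram σ H P.val).det = ∏ i, twistGram σ H P.val i i := by
    rw [twistGram_eigenframe_eq_diagonal σ H hγ hP hu hu1, det_diagonal]
    simp only [diagonal_apply_eq]
  rw [← h1, ← h2, det_twistGram, det_twistGram, Matrix.det_mul, map_mul]
  ring

end Frame

/-! ## §2 Local realisation at a non-split place (rank 3) and the type (1) frame ratios -/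

section Local

variable {F : Type} (E : Type) [Field F] [NumberField F] [Field E] [NumberField E] [Algebra F E]
  [Algebra.IsQuadraticExtension F E] (v : HeightOneSpectrum (𝓞 F)) (c : E ≃ₐ[F] E) {δ : E} (hcδ : c δ = -δ) (hδ : δ ≠ 0)

include hcδ hδ in
/-- **A `⋆`-symmetric `x` is a Cartan class iff `det x` is a norm** (rank 3, LOCAL coefficients, non-split `v`): for `H ∈ M₃(E_v)` `(c ⊗ 1)`-hermitian
with unit determinant and `x` with `x⋆ = x` (★ `hermStar`), `det x` a unit: `(∃ g ∈ GL₃(E_v), H_g = H · x) ↔ ∃ z ∈ E_vˣ, det x = σ(z) z` — the LOCAL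
twin of ★ `exists_gl_twistGram_eq_mul_iff_invariants` (no signatures at a finite place; ★ `exists_formCongr_eq_iff_det_three`).
[cite: Rogawski1990, §3.5 Prop. 3.5.2 (a) p. 29] [cite: Jacobowitz1962, §3 Thm. 3.1] -/
theorem exists_twistGram_eq_mul_iff_det (w : PlacesOver E v) (hw : c • w.1 = w.1)
    {H : Matrix (Fin 3) (Fin 3) (LocalRing E v)} (hH : (H.map (conjLocal E c v))ᵀ = H) (hHd : IsUnit H.det)
    {x : Matrix (Fin 3) (Fin 3) (LocalRing E v)} (hx : hermStar (conjLocal E c v) H x = x) (hxd : IsUnit x.det) :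
    (∃ g : GL (Fin 3) (LocalRing E v), twistGram (conjLocal E c v) H g.val = H * x) ↔
      ∃ z : LocalRing E v, IsUnit z ∧ x.det = conjLocal E c v z * z := by
  have hHx : ((H * x).map (conjLocal E c v))ᵀ = H * x := (conjTranspose_mul_eq_self_iff (conjLocal E c v) H hH hHd x).2 hx
  have hHxd : IsUnit (H * x).det := by rw [Matrix.det_mul]; exact hHd.mul hxd
  have key := exists_formCongr_eq_iff_det_three E v c hcδ hδ w hw hH hHx hHd hHxd
  have e1 : (∃ T : GL (Fin 3) (LocalRing E v), formCongr (conjLocal E c v) T H = H * x) ↔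
      ∃ g : GL (Fin 3) (LocalRing E v), twistGram (conjLocal E c v) H g.val = H * x :=
    exists_congr fun T => Iff.rfl
  rw [← e1, key, Matrix.det_mul]
  refine exists_congr fun z => and_congr_right fun _ => ?_
  constructor
  · intro h
    exact hHd.mul_left_cancel (by rw [h])
  · intro h
    rw [h]

include hcδ hδ in
/-- **LOCAL REALISATION OF A CARTAN CLASS** (the (→) of [Prop. 3.3.1] at ONE non-split finite place; no Hasse principle): `γ ∈ U(H)(F_v)` (`H ∈ M₃(E_v)`
hermitian, unit determinant), `x ∈ Z(γ)` with `x⋆ = x` and `det x = σ(z) z` a NORM ⟹ there are `g ∈ GL₃(E_v)` and `δ ∈ U(H)(F_v)` with `g γ g⁻¹ = δ`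
— so `γ ∼_st δ` — and Cartan class `H⁻¹ H_g = x`.  [cite: Rogawski1990, §3.1 p. 19; §3.3 Prop. 3.3.1 p. 22; §3.5 Prop. 3.5.2 (a) p. 29] [cite: Kottwitz1986, §7] -/
theorem exists_isStablyConj_inv_mul_twistGram_eq_of_det (w : PlacesOver E v) (hw : c • w.1 = w.1)
    {H : Matrix (Fin 3) (Fin 3) (LocalRing E v)} (hH : (H.map (conjLocal E c v))ᵀ = H) (hHd : IsUnit H.det)
    (γ : unitaryGroup (conjLocal E c v) H) {x : Matrix (Fin 3) (Fin 3) (LocalRing E v)}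
    (hxγ : Commute x γ.val.val)
    (hx : hermStar (conjLocal E c v) H x = x) (hdet : ∃ z : LocalRing E v, IsUnit z ∧ x.det = conjLocal E c v z * z) :
    ∃ (g : GL (Fin 3) (LocalRing E v)) (δ' : unitaryGroup (conjLocal E c v) H),
      g * γ.val * g⁻¹ = δ'.val ∧ IsStablyConj (conjLocal E c v) H γ δ' ∧
        H⁻¹ * twistGram (conjLocal E c v) H g.val = x := by
  have hxd : IsUnit x.det := by
    obtain ⟨z, hz, h⟩ := hdet
    rw [h]
    exact (hz.map (conjLocal E c v)).mul hz
  obtain ⟨g, hg⟩ := (exists_twistGram_eq_mul_iff_det E v c hcδ hδ w hw hH hHd hx hxd).2 hdet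
  obtain ⟨δ', hδ', hst, hcl⟩ := exists_unitary_conj_eq_of_twistGram_eq_mul (conjLocal E c v) H hHd γ hxγ hg
  exact ⟨g, δ', hδ', hst, hcl⟩

include hcδ hδ in
/-- **EVERY vector of `σ`-fixed unit frame ratios with norm product is REALISED (type (1), non-split `v`, rank 3).**  `γ ∈ U(H)(F_v)` with eigenframe
`γ P = P · diag(u)` (`u` injective, norm-one); for `r = (r₁, r₂, r₃)` with `σ(rᵢ) = rᵢ` units and `∏ rᵢ = σ(z) z`: there is a stable conjugator `g`
(`g γ g⁻¹ ∈ U(H)(F_v)`) whose eigenvector lengths are `⟨g pᵢ, g pᵢ⟩_H = rᵢ · ⟨pᵢ, pᵢ⟩_H` — `x := P · diag(r) · P⁻¹ ∈ Z(γ)` is `⋆`-symmetric with norm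
determinant, so `H · x = H_g` (§2 realisation) and `H_{gP} = H_P · diag(r)`.  With the sequel's criterion this is the SURJECTIVITY of the class set of `γ` onto
`{(rᵢ) ∈ (F_vˣ ∕ N E_vˣ)³ : ∏ rᵢ ∈ N}` = `𝓔(T∕F_v)` of [Prop. 3.5.2 (c)]. [cite: Rogawski1990, §3.5 Prop. 3.5.2 (a)(c) p. 29; §3.6 p. 31] [cite: Kottwitz1986, §7] -/
theorem exists_conj_mem_twistGram_eigenframe_eq (w : PlacesOver E v) (hw : c • w.1 = w.1)
    {H : Matrix (Fin 3) (Fin 3) (LocalRing E v)} (hH : (H.map (conjLocal E c v))ᵀ = H) (hHd : IsUnit H.det)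
    {γ : GL (Fin 3) (LocalRing E v)} (hγ : γ ∈ unitaryGroup (conjLocal E c v) H) {P : GL (Fin 3) (LocalRing E v)} {u : Fin 3 → LocalRing E v}
    (hP : γ.val * P.val = P.val * diagonal u) (hu : Function.Injective u) (hu1 : ∀ i, conjLocal E c v (u i) * u i = 1)
    (r : Fin 3 → LocalRing E v) (hσr : ∀ i, conjLocal E c v (r i) = r i) (hr : ∀ i, IsUnit (r i))
    (hprod : ∃ z : LocalRing E v, IsUnit z ∧ ∏ i, r i = conjLocal E c v z * z) :
    ∃ g : GL (Fin 3) (LocalRing E v), g * γ * g⁻¹ ∈ unitaryGroup (conjLocal E c v) H ∧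
      ∀ i, twistGram (conjLocal E c v) H (g.val * P.val) i i = r i * twistGram (conjLocal E c v) H P.val i i := by
  letI : Field (LocalRing E v) :=
    (Liu2021.LemD1IndexedNonVacuityNonsplitPlace.isField_localRing_of_nonsplit E v c hcδ hδ w hw).toField
  set x : Matrix (Fin 3) (Fin 3) (LocalRing E v) := P.val * diagonal r * (P⁻¹).val with hxdef
  have hxγ : Commute x γ.val := commute_eigenframe_diagonal hP r
  have hx : hermStar (conjLocal E c v) H x = x :=
    (hermStar_eigenframe_diagonal_eq_self_iff (conjLocal E c v) H hHd.ne_zero hγ hP hu hu1 r).2 hσr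
  have hxdet : x.det = ∏ i, r i := det_eigenframe_diagonal P r
  have hxd : IsUnit x.det := by
    rw [hxdet]
    exact Ne.isUnit (Finset.prod_ne_zero_iff.2 fun i _ => (hr i).ne_zero)
  have hdet : ∃ z : LocalRing E v, IsUnit z ∧ x.det = conjLocal E c v z * z := by
    obtain ⟨z, hz, h⟩ := hprod
    exact ⟨z, hz, hxdet.trans h⟩
  obtain ⟨g, hg⟩ := (exists_twistGram_eq_mul_iff_det E v c hcδ hδ w hw hH hHd hx hxd).2 hdet
  refine ⟨g, conj_mem_unitaryGroup_of_twistGram_eq_mul (conjLocal E c v) H hγ hxγ hg, fun i => ?_⟩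
  have hframe : twistGram (conjLocal E c v) H (g.val * P.val) = twistGram (conjLocal E c v) H P.val * diagonal r := by
    rw [twistGram_mul, hg, hxdef, twistGram_frame_mul_eigenframe_diagonal]
  rw [hframe, mul_diagonal, mul_comm]

end Local

end Literature.NumberTheory.Rogawski1990

end
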